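import Literature.NumberTheory.Sieve.HeathBrownSSumLemma4

/-!
# Heath-Brown's Lemma 1 (the prime case of the `S`-sum bound) modulo Birch–Bombieri, and Lemma 4

Source: D. R. Heath-Brown, *The divisor function `d₃(n)` in arithmetic progressions*, Acta Arith. 47
(1986) 29–56, §3, Lemma 1 (pp. 36–38) and Lemma 4 [cite: HeathBrown1986d3].  No named facts are
introduced: the Birch–Bombieri bound `|S'(α, β; p)| ≤ C p^{3/2}` (`p ∤ αβ`; the appendix to [10], a
consequence of Deligne's theorem) enters as an explicit hypothesis `hBB` on the sum `BBsum`.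

* `gp`, `vz` — the weights `p^{[x ≡ 0]}`; `norm_K2_first_zero_le`, `norm_K2_second_zero_le`,
  `norm_SS_prime_first_zero_le`, `norm_SS_prime_second_zero_le`, `norm_SS_prime_le_cube` — the degenerate
  cases `ρσ ≡ 0` or `t₁t₂ ≡ 0` of Lemma 1 (trivial / Ramanujan bounds, HB p. 36).
* `Sp`, `SS_prime_eq` — opening `|K₂|²` and summing over `j`: `S = p·Sp − (…)` (HB p. 37);
  `Sp_zero_eq`, `norm_Sp_zero_le` — the case `k ≡ 0` (a Kloosterman/Ramanujan evaluation);
  `BBsum`, `Sp_eq_BBsum` — the case `k ≢ 0` reduces to the Birch–Bombieri sum `S'(α, β; p)`.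
* `norm_SS_prime_le_of_BB` — **Lemma 1 modulo Birch–Bombieri**:
  `|S(k,t₁,t₂,ρ,σ;p)| ≤ (C+3) p^{5/2} (p^{[k≡0 ∧ t₁≡t₂] + v(t₁) + v(t₂) + v(ρ) + v(σ)})^{1/2}`.
* `norm_SS_prime_le_L4B_of_BB` — the same in the `L4B` form of Lemma 4; and the capstones
  `norm_SS_le_L4B_of_BB`, `norm_SS_le_dA_L4B_of_BB` — **Lemma 4 modulo Birch–Bombieri** at every
  modulus (`|S| ≤ max(C+3,96)^{ω(q)} L4B ≤ d(q)^{log₂ max(C+3,96)} L4B`), by `norm_SS_le_L4B`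
  (multiplicativity (3.4), prime powers (3.5) and Lemmas 2–3, in `HeathBrownSSumLemma4`).
-/

open Finset

namespace Literature.NumberTheory.Sieve.HeathBrown1986

open Literature.NumberTheory.LFunctions (norm_stdAddChar)

section Lemma1

variable {p : ℕ} [hp : Fact p.Prime]

/-- `∑_{j unit} e_p(kj) = p[k = 0] − 1` (Ramanujan sum at a prime). [folklore] -/
theorem sum_isUnit_stdAddChar (k : ZMod p) :
    ∑ j : ZMod p, (if IsUnit j then (ZMod.stdAddChar (k * j) : ℂ) else 0) =
      (if k = 0 then (p : ℂ) else 0) - 1 := by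
  classical
  have h1 : ∀ j : ZMod p, (if IsUnit j then (ZMod.stdAddChar (k * j) : ℂ) else 0) =
      if j ≠ 0 then (ZMod.stdAddChar (k * j) : ℂ) else 0 := fun j => by
    simp only [isUnit_iff_ne_zero_prime]
  simp_rw [h1]
  rw [← Finset.sum_filter, Finset.filter_ne', ← sum_ne_zero_stdAddChar]

/-- The weight `(x, p)` at a prime: `p` if `x ≡ 0`, else `1`. [cite: HeathBrown1986d3, Lemma 1] -/
noncomputable def gp (p : ℕ) (x : ZMod p) : ℝ := by
  classical
  exact if x = 0 then (p : ℝ) else 1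

/-- Unfolding `gp`. [folklore] -/
theorem gp_def (x : ZMod p) : gp p x = if x = 0 then (p : ℝ) else 1 := by
  unfold gp; congr

omit hp in
/-- `1 ≤ (x, p)`. [folklore] -/
theorem one_le_gp (hp1 : 1 ≤ p) (x : ZMod p) : 1 ≤ gp p x := by
  unfold gp; split_ifs
  · exact_mod_cast hp1
  · exact le_rfl

omit hp in
/-- `0 ≤ (x, p)`. [folklore] -/
theorem gp_nonneg (x : ZMod p) : 0 ≤ gp p x := by
  unfold gp; split_ifs <;> positivity

omit hp in
/-- `(x, p) ≤ p`. [folklore] -/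
theorem gp_le (x : ZMod p) (hp1 : 1 ≤ p) : gp p x ≤ p := by
  unfold gp; split_ifs
  · exact le_rfl
  · exact_mod_cast hp1

/-- `|p[k = 0] − 1| ≤ (k, p)`. [folklore] -/
theorem norm_ramanujan_le_gp (k : ZMod p) : ‖(if k = 0 then (p : ℂ) else 0) - 1‖ ≤ gp p k := by
  have hp1 : (1 : ℝ) ≤ p := by exact_mod_cast hp.out.one_lt.le
  unfold gp
  split_ifs with hk
  · have : ((p : ℂ) - 1) = (((p : ℝ) - 1 : ℝ) : ℂ) := by push_cast; ring
    rw [this, Complex.norm_real, Real.norm_eq_abs, abs_of_nonneg (by linarith)]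
    linarith
  · simp

/-- `K₂(0, σ, jt; p) = K₂(0, σ, t; p)` for a unit `j` (the value only depends on whether `t = 0`).
[cite: HeathBrown1986d3, (3.6)–(3.8)] -/
theorem K2_first_zero_mul_unit {j : ZMod p} (hj : IsUnit j) (σ t : ZMod p) :
    K2 p 0 σ (j * t) = K2 p 0 σ t := by
  by_cases ht : t = 0
  · rw [ht, mul_zero]
  · have hjt : j * t ≠ 0 := mul_ne_zero ((isUnit_iff_ne_zero_prime j).mp hj) ht
    rw [K2_first_zero hjt, K2_first_zero ht]

/-- `K₂(ρ, 0, jt; p) = K₂(ρ, 0, t; p)` for a unit `j`. [cite: HeathBrown1986d3, (3.6)–(3.8)] -/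
theorem K2_second_zero_mul_unit {j : ZMod p} (hj : IsUnit j) (ρ t : ZMod p) :
    K2 p ρ 0 (j * t) = K2 p ρ 0 t := by
  by_cases ht : t = 0
  · rw [ht, mul_zero]
  · have hjt : j * t ≠ 0 := mul_ne_zero ((isUnit_iff_ne_zero_prime j).mp hj) ht
    rw [K2_second_zero hjt, K2_second_zero ht]

/-- `|K₂(0, σ, t; p)| ≤ (t, p)(σ, p)`. [cite: HeathBrown1986d3, (3.6)–(3.8)] -/
theorem norm_K2_first_zero_le (σ t : ZMod p) : ‖K2 p 0 σ t‖ ≤ gp p t * gp p σ := by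
  have hp1 : (1 : ℝ) ≤ p := by exact_mod_cast hp.out.one_lt.le
  have hn : ‖((p : ℂ) - 1)‖ ≤ p := by
    have : ((p : ℂ) - 1) = (((p : ℝ) - 1 : ℝ) : ℂ) := by push_cast; ring
    rw [this, Complex.norm_real, Real.norm_eq_abs, abs_of_nonneg (by linarith)]; linarith
  by_cases ht : t = 0
  · rw [ht, K2_third_zero, norm_mul, if_pos rfl, gp_def (0 : ZMod p), if_pos rfl]
    exact mul_le_mul hn (norm_ramanujan_le_gp σ) (norm_nonneg _) (Nat.cast_nonneg p)
  · rw [K2_first_zero ht, norm_neg]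
    refine (norm_ramanujan_le_gp σ).trans ?_
    exact le_mul_of_one_le_left (gp_nonneg _) (one_le_gp hp.out.one_lt.le _)

/-- `|K₂(ρ, 0, t; p)| ≤ (t, p)(ρ, p)`. [cite: HeathBrown1986d3, (3.6)–(3.8)] -/
theorem norm_K2_second_zero_le (ρ t : ZMod p) : ‖K2 p ρ 0 t‖ ≤ gp p t * gp p ρ := by
  have hp1 : (1 : ℝ) ≤ p := by exact_mod_cast hp.out.one_lt.le
  have hn : ‖((p : ℂ) - 1)‖ ≤ p := by
    have : ((p : ℂ) - 1) = (((p : ℝ) - 1 : ℝ) : ℂ) := by push_cast; ring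
    rw [this, Complex.norm_real, Real.norm_eq_abs, abs_of_nonneg (by linarith)]; linarith
  by_cases ht : t = 0
  · rw [ht, K2_third_zero, norm_mul, if_pos (rfl : (0 : ZMod p) = 0), gp_def (0 : ZMod p), if_pos rfl,
      mul_comm]
    exact mul_le_mul hn (norm_ramanujan_le_gp ρ) (norm_nonneg _) (Nat.cast_nonneg p)
  · rw [K2_second_zero ht, norm_neg]
    refine (norm_ramanujan_le_gp ρ).trans ?_
    exact le_mul_of_one_le_left (gp_nonneg _) (one_le_gp hp.out.one_lt.le _)

/-- **`ρ ≡ 0`**: `S = (p[k=0] − 1) K₂(0, σ, t₁) conj K₂(0, σ, t₂)`, so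
`|S| ≤ (k,p)(t₁,p)(t₂,p)(σ,p)²`. [cite: HeathBrown1986d3, Lemma 1 (p.37)] -/
theorem norm_SS_prime_first_zero_le (k t₁ t₂ σ : ZMod p) :
    ‖SS p k t₁ t₂ 0 σ‖ ≤ gp p k * (gp p t₁ * gp p σ) * (gp p t₂ * gp p σ) := by
  classical
  have hS : SS p k t₁ t₂ 0 σ = (∑ j : ZMod p, (if IsUnit j then (ZMod.stdAddChar (k * j) : ℂ) else 0)) *
      (K2 p 0 σ t₁ * starRingEnd ℂ (K2 p 0 σ t₂)) := by
    unfold SS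
    rw [Finset.sum_mul]
    refine Finset.sum_congr rfl fun j _ => ?_
    split_ifs with hj
    · rw [K2_first_zero_mul_unit hj, K2_first_zero_mul_unit hj]; ring
    · rw [zero_mul]
  rw [hS, sum_isUnit_stdAddChar, norm_mul, norm_mul, Complex.norm_conj]
  have h1 := norm_ramanujan_le_gp k
  have h2 := norm_K2_first_zero_le σ t₁
  have h3 := norm_K2_first_zero_le σ t₂
  rw [mul_assoc (gp p k)]
  exact mul_le_mul h1 (mul_le_mul h2 h3 (norm_nonneg _) (mul_nonneg (gp_nonneg _) (gp_nonneg _)))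
    (by positivity) (gp_nonneg _)

/-- **`σ ≡ 0`**: `|S| ≤ (k,p)(t₁,p)(t₂,p)(ρ,p)²`. [cite: HeathBrown1986d3, Lemma 1 (p.37)] -/
theorem norm_SS_prime_second_zero_le (k t₁ t₂ ρ : ZMod p) :
    ‖SS p k t₁ t₂ ρ 0‖ ≤ gp p k * (gp p t₁ * gp p ρ) * (gp p t₂ * gp p ρ) := by
  classical
  have hS : SS p k t₁ t₂ ρ 0 = (∑ j : ZMod p, (if IsUnit j then (ZMod.stdAddChar (k * j) : ℂ) else 0)) *
      (K2 p ρ 0 t₁ * starRingEnd ℂ (K2 p ρ 0 t₂)) := by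
    unfold SS
    rw [Finset.sum_mul]
    refine Finset.sum_congr rfl fun j _ => ?_
    split_ifs with hj
    · rw [K2_second_zero_mul_unit hj, K2_second_zero_mul_unit hj]; ring
    · rw [zero_mul]
  rw [hS, sum_isUnit_stdAddChar, norm_mul, norm_mul, Complex.norm_conj]
  have h1 := norm_ramanujan_le_gp k
  have h2 := norm_K2_second_zero_le ρ t₁
  have h3 := norm_K2_second_zero_le ρ t₂
  rw [mul_assoc (gp p k)]
  exact mul_le_mul h1 (mul_le_mul h2 h3 (norm_nonneg _) (mul_nonneg (gp_nonneg _) (gp_nonneg _)))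
    (by positivity) (gp_nonneg _)

/-- **`t₂ ≡ 0`, `ρσ ≢ 0`**: `conj K₂(ρ, σ, 0) = 1`, so `|S| ≤ ∑*|K₂(ρ, σ, jt₁)| ≤ p³` (trivial bound;
HB uses (3.1) here, which is not needed). [cite: HeathBrown1986d3, Lemma 1 (p.37)] -/
theorem norm_SS_prime_le_cube (k t₁ t₂ ρ σ : ZMod p) (h : t₁ = 0 ∨ t₂ = 0) (hρ : ρ ≠ 0) (hσ : σ ≠ 0) :
    ‖SS p k t₁ t₂ ρ σ‖ ≤ (p : ℝ) ^ 3 := by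
  classical
  have h0 : K2 p ρ σ 0 = 1 := by rw [K2_third_zero, if_neg hρ, if_neg hσ]; ring
  have hp0 : (0 : ℝ) ≤ p := Nat.cast_nonneg p
  unfold SS
  refine (norm_sum_le _ _).trans ?_
  calc ∑ j : ZMod p, ‖(if IsUnit j then (ZMod.stdAddChar (k * j) : ℂ) * K2 p ρ σ (j * t₁) *
        starRingEnd ℂ (K2 p ρ σ (j * t₂)) else 0)‖ ≤ ∑ _j : ZMod p, (p : ℝ) ^ 2 := by
        refine Finset.sum_le_sum fun j _ => ?_
        split_ifs with hj
        · rw [norm_mul, norm_mul, norm_stdAddChar, one_mul, Complex.norm_conj]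
          rcases h with h1 | h2
          · rw [h1, mul_zero, h0, norm_one, one_mul]
            exact (norm_K2_le_sq p _ _ _).trans (le_of_eq (by ring))
          · rw [h2, mul_zero, h0, norm_one, mul_one]
            exact (norm_K2_le_sq p _ _ _).trans (le_of_eq (by ring))
        · rw [norm_zero]; positivity
    _ = (p : ℝ) ^ 3 := by rw [Finset.sum_const, Finset.card_univ, ZMod.card, nsmul_eq_mul]; ring


/-! #### (3.9)–(3.10): `S = p S' − K₂(ρ,σ,0) conj K₂(ρ,σ,0)` -/

/-- HB's `S'` of (3.10) (before the normalising substitution):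
`S' = ∑*_{x,y,X,Y : k + t₁x̄ȳ − t₂X̄Ȳ ≡ 0} e_p(ρx + σy − ρX − σY)`. [cite: HeathBrown1986d3, (3.10)] -/
noncomputable def Sp (p : ℕ) [NeZero p] (k t₁ t₂ ρ σ : ZMod p) : ℂ := by
  classical
  exact ∑ x : ZMod p, ∑ y : ZMod p, ∑ X : ZMod p, ∑ Y : ZMod p,
    if (IsUnit x ∧ IsUnit y) ∧ (IsUnit X ∧ IsUnit Y) ∧ k + t₁ * (x⁻¹ * y⁻¹) - t₂ * (X⁻¹ * Y⁻¹) = 0 then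
      (ZMod.stdAddChar (ρ * x + σ * y - ρ * X - σ * Y) : ℂ) else 0

set_option maxHeartbeats 1600000 in
/-- **(3.9)**: `∑_{j mod p} e_p(kj) K₂(ρ, σ, jt₁) conj K₂(ρ, σ, jt₂) = p S'` (orthogonality in `j`).
[cite: HeathBrown1986d3, (3.9)–(3.10)] -/
theorem sum_stdAddChar_K2_mul_conj (k t₁ t₂ ρ σ : ZMod p) :
    ∑ j : ZMod p, (ZMod.stdAddChar (k * j) : ℂ) * K2 p ρ σ (j * t₁) * starRingEnd ℂ (K2 p ρ σ (j * t₂)) =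
      (p : ℂ) * Sp p k t₁ t₂ ρ σ := by
  classical
  -- expand
  have hterm : ∀ j : ZMod p, (ZMod.stdAddChar (k * j) : ℂ) * K2 p ρ σ (j * t₁) *
      starRingEnd ℂ (K2 p ρ σ (j * t₂)) =
      ∑ x : ZMod p, ∑ y : ZMod p, ∑ X : ZMod p, ∑ Y : ZMod p,
        if (IsUnit x ∧ IsUnit y) ∧ (IsUnit X ∧ IsUnit Y) then
          (ZMod.stdAddChar (ρ * x + σ * y - ρ * X - σ * Y) : ℂ) *
            ZMod.stdAddChar (j * (k + t₁ * (x⁻¹ * y⁻¹) - t₂ * (X⁻¹ * Y⁻¹))) else 0 := by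
    intro j
    rw [conj_K2]
    unfold K2
    rw [Finset.mul_sum (a := (ZMod.stdAddChar (k * j) : ℂ)), Finset.sum_mul]
    refine Finset.sum_congr rfl fun x _ => ?_
    rw [Finset.mul_sum (a := (ZMod.stdAddChar (k * j) : ℂ)), Finset.sum_mul]
    refine Finset.sum_congr rfl fun y _ => ?_
    rw [Finset.mul_sum]
    refine Finset.sum_congr rfl fun X _ => ?_
    rw [Finset.mul_sum]
    refine Finset.sum_congr rfl fun Y _ => ?_
    by_cases hxy : IsUnit x ∧ IsUnit y
    · by_cases hXY : IsUnit X ∧ IsUnit Y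
      · rw [if_pos hxy, if_pos hXY, if_pos ⟨hxy, hXY⟩, ← AddChar.map_add_eq_mul, ← AddChar.map_add_eq_mul,
          ← AddChar.map_add_eq_mul]
        congr 1; ring
      · rw [if_neg hXY, mul_zero, if_neg (fun h => hXY h.2)]
    · rw [if_neg hxy, mul_zero, zero_mul, if_neg (fun h => hxy h.1)]
  simp_rw [hterm]
  -- move `j` innermost and sum it
  rw [Finset.sum_comm]
  unfold Sp
  rw [Finset.mul_sum]
  refine Finset.sum_congr rfl fun x _ => ?_
  rw [Finset.sum_comm, Finset.mul_sum]
  refine Finset.sum_congr rfl fun y _ => ?_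
  rw [Finset.sum_comm, Finset.mul_sum]
  refine Finset.sum_congr rfl fun X _ => ?_
  rw [Finset.sum_comm, Finset.mul_sum]
  refine Finset.sum_congr rfl fun Y _ => ?_
  by_cases hu : (IsUnit x ∧ IsUnit y) ∧ (IsUnit X ∧ IsUnit Y)
  · simp only [if_pos hu]
    rw [← Finset.mul_sum, sum_stdAddChar_mul_right]
    by_cases hc : k + t₁ * (x⁻¹ * y⁻¹) - t₂ * (X⁻¹ * Y⁻¹) = 0
    · rw [if_pos hc, if_pos ⟨hu.1, hu.2, hc⟩, mul_comm]
    · rw [if_neg hc, mul_zero, if_neg (fun h => hc h.2.2), mul_zero]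
  · simp only [if_neg hu, Finset.sum_const_zero]
    rw [if_neg (fun h => hu ⟨h.1, h.2.1⟩), mul_zero]

/-- **`S = p S' − K₂(ρ,σ,0;p) conj K₂(ρ,σ,0;p)`** (the `j = 0` term). [cite: HeathBrown1986d3, (3.9)] -/
theorem SS_prime_eq (k t₁ t₂ ρ σ : ZMod p) :
    SS p k t₁ t₂ ρ σ = (p : ℂ) * Sp p k t₁ t₂ ρ σ - K2 p ρ σ 0 * starRingEnd ℂ (K2 p ρ σ 0) := by
  classical
  rw [← sum_stdAddChar_K2_mul_conj, eq_sub_iff_add_eq]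
  unfold SS
  have h0 : (ZMod.stdAddChar (k * 0) : ℂ) * K2 p ρ σ (0 * t₁) * starRingEnd ℂ (K2 p ρ σ (0 * t₂)) =
      K2 p ρ σ 0 * starRingEnd ℂ (K2 p ρ σ 0) := by
    rw [mul_zero, zero_mul, zero_mul, AddChar.map_zero_eq_one, one_mul]
  rw [Finset.sum_eq_sum_sdiff_singleton_add (Finset.mem_univ (0 : ZMod p))]
  conv_rhs => rw [Finset.sum_eq_sum_sdiff_singleton_add (Finset.mem_univ (0 : ZMod p))]
  rw [if_neg not_isUnit_zero, add_zero, h0]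
  congr 1
  refine Finset.sum_congr rfl fun j hj => ?_
  have hj0 : j ≠ 0 := by simpa using hj
  rw [if_pos ((isUnit_iff_ne_zero_prime j).mpr hj0)]


/-! #### `k ≡ 0`: evaluation of `S'` -/

set_option maxHeartbeats 1600000 in
/-- For `t₁, t₂ ≢ 0`, eliminating `Y` and summing over `y`:
`S'(0, t₁, t₂, ρ, σ) = ∑*_{x,X} e_p(ρ(x − X)) (p[σ(1 − t₂t₁⁻¹xX̄) = 0] − 1)`.
[cite: HeathBrown1986d3, Lemma 1 (p.37)] -/
theorem Sp_zero_eq {t₁ t₂ : ZMod p} (ht₁ : t₁ ≠ 0) (ht₂ : t₂ ≠ 0) (ρ σ : ZMod p) :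
    Sp p 0 t₁ t₂ ρ σ = ∑ x : ZMod p, ∑ X : ZMod p, if IsUnit x ∧ IsUnit X then
      (ZMod.stdAddChar (ρ * (x - X)) : ℂ) *
        ((if σ * (1 - t₂ * t₁⁻¹ * x * X⁻¹) = 0 then (p : ℂ) else 0) - 1) else 0 := by
  classical
  have i1 : t₁ * t₁⁻¹ = 1 := ZMod.mul_inv_of_unit _ ((isUnit_iff_ne_zero_prime t₁).mpr ht₁)
  have i2 : t₂ * t₂⁻¹ = 1 := ZMod.mul_inv_of_unit _ ((isUnit_iff_ne_zero_prime t₂).mpr ht₂)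
  unfold Sp
  refine Finset.sum_congr rfl fun x _ => ?_
  rw [Finset.sum_comm]
  refine Finset.sum_congr rfl fun X _ => ?_
  by_cases hxX : IsUnit x ∧ IsUnit X
  swap
  · rw [if_neg hxX]
    refine Finset.sum_eq_zero fun y _ => Finset.sum_eq_zero fun Y _ => ?_
    rw [if_neg]
    rintro ⟨⟨hx, _⟩, ⟨hX, _⟩, _⟩
    exact hxX ⟨hx, hX⟩
  obtain ⟨hx, hX⟩ := hxX
  rw [if_pos ⟨hx, hX⟩]
  have ix : x * x⁻¹ = 1 := ZMod.mul_inv_of_unit _ hx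
  have iX : X * X⁻¹ = 1 := ZMod.mul_inv_of_unit _ hX
  -- the `Y`-sum has the single term `Y₀ = t₂ t₁⁻¹ x y X⁻¹`
  have hY : ∀ y : ZMod p, IsUnit y →
      ∑ Y : ZMod p, (if (IsUnit x ∧ IsUnit y) ∧ (IsUnit X ∧ IsUnit Y) ∧
          (0 : ZMod p) + t₁ * (x⁻¹ * y⁻¹) - t₂ * (X⁻¹ * Y⁻¹) = 0 then
        (ZMod.stdAddChar (ρ * x + σ * y - ρ * X - σ * Y) : ℂ) else 0) =
      ZMod.stdAddChar (ρ * x + σ * y - ρ * X - σ * (t₂ * t₁⁻¹ * x * y * X⁻¹)) := by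
    intro y hy
    have iy : y * y⁻¹ = 1 := ZMod.mul_inv_of_unit _ hy
    set Y₀ : ZMod p := t₂ * t₁⁻¹ * x * y * X⁻¹ with hY₀
    have hY₀u : IsUnit Y₀ := by
      rw [isUnit_iff_ne_zero_prime]
      rw [isUnit_iff_ne_zero_prime] at hx hy hX
      have hti : t₁⁻¹ ≠ 0 := fun h => by rw [h, mul_zero] at i1; exact zero_ne_one i1
      have hXi : X⁻¹ ≠ 0 := fun h => by rw [h, mul_zero] at iX; exact zero_ne_one iX
      exact mul_ne_zero (mul_ne_zero (mul_ne_zero (mul_ne_zero ht₂ hti) hx) hy) hXi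
    have iY₀ : Y₀ * Y₀⁻¹ = 1 := ZMod.mul_inv_of_unit _ hY₀u
    rw [Finset.sum_eq_single Y₀]
    · rw [if_pos]
      refine ⟨⟨hx, hy⟩, ⟨hX, hY₀u⟩, ?_⟩
      have hinv : Y₀⁻¹ = t₁ * t₂⁻¹ * x⁻¹ * y⁻¹ * X := by
        apply ZMod.inv_eq_of_mul_eq_one
        rw [hY₀]
        linear_combination (t₁ * t₁⁻¹ * (x * x⁻¹) * (y * y⁻¹) * (X * X⁻¹)) * i2 +
          ((x * x⁻¹) * (y * y⁻¹) * (X * X⁻¹)) * i1 + ((y * y⁻¹) * (X * X⁻¹)) * ix + (X * X⁻¹) * iy + iX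
      rw [hinv]
      linear_combination (-(t₁ * x⁻¹ * y⁻¹ * (X * X⁻¹))) * i2 + (-(t₁ * x⁻¹ * y⁻¹)) * iX
    · intro Y _ hYne
      rw [if_neg]
      rintro ⟨_, ⟨_, hYu⟩, hc⟩
      apply hYne
      have iY : Y * Y⁻¹ = 1 := ZMod.mul_inv_of_unit _ hYu
      rw [hY₀]
      linear_combination (Y * t₁⁻¹ * x * y) * hc + (-(Y * (x * x⁻¹) * (y * y⁻¹))) * i1 +
        (-(Y * (y * y⁻¹))) * ix + (-Y) * iy + (t₂ * t₁⁻¹ * x * y * X⁻¹) * iY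
    · intro h; exact absurd (Finset.mem_univ _) h
  -- the `y`-sum
  have hy' : ∀ y : ZMod p, (∑ Y : ZMod p, (if (IsUnit x ∧ IsUnit y) ∧ (IsUnit X ∧ IsUnit Y) ∧
          (0 : ZMod p) + t₁ * (x⁻¹ * y⁻¹) - t₂ * (X⁻¹ * Y⁻¹) = 0 then
        (ZMod.stdAddChar (ρ * x + σ * y - ρ * X - σ * Y) : ℂ) else 0)) =
      if IsUnit y then (ZMod.stdAddChar (ρ * (x - X)) : ℂ) *
        ZMod.stdAddChar ((σ * (1 - t₂ * t₁⁻¹ * x * X⁻¹)) * y) else 0 := by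
    intro y
    by_cases hy : IsUnit y
    · rw [hY y hy, if_pos hy, ← AddChar.map_add_eq_mul]
      congr 1; ring
    · rw [if_neg hy]
      refine Finset.sum_eq_zero fun Y _ => ?_
      rw [if_neg]
      rintro ⟨⟨_, hy'⟩, _, _⟩
      exact hy hy'
  simp_rw [hy']
  have : ∀ y : ZMod p, (if IsUnit y then (ZMod.stdAddChar (ρ * (x - X)) : ℂ) *
        ZMod.stdAddChar ((σ * (1 - t₂ * t₁⁻¹ * x * X⁻¹)) * y) else 0) =
      (ZMod.stdAddChar (ρ * (x - X)) : ℂ) *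
        (if IsUnit y then (ZMod.stdAddChar ((σ * (1 - t₂ * t₁⁻¹ * x * X⁻¹)) * y) : ℂ) else 0) := by
    intro y; split_ifs <;> simp
  simp_rw [this]
  rw [← Finset.mul_sum, sum_isUnit_stdAddChar]


set_option maxHeartbeats 1600000 in
/-- **`k ≡ 0`, `ρ, σ, t₁, t₂ ≢ 0`**: `|S'(0, t₁, t₂, ρ, σ)| ≤ p (t₁ − t₂, p) + 1`
(HB: `S' ≪ p²` if `p ∣ t₁ − t₂`, `≪ p` otherwise). [cite: HeathBrown1986d3, Lemma 1 (p.37)] -/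
theorem norm_Sp_zero_le {t₁ t₂ ρ σ : ZMod p} (ht₁ : t₁ ≠ 0) (ht₂ : t₂ ≠ 0) (hρ : ρ ≠ 0) (hσ : σ ≠ 0) :
    ‖Sp p 0 t₁ t₂ ρ σ‖ ≤ p * gp p (t₁ - t₂) + 1 := by
  classical
  have i1 : t₁ * t₁⁻¹ = 1 := ZMod.mul_inv_of_unit _ ((isUnit_iff_ne_zero_prime t₁).mpr ht₁)
  have i2 : t₂ * t₂⁻¹ = 1 := ZMod.mul_inv_of_unit _ ((isUnit_iff_ne_zero_prime t₂).mpr ht₂)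
  have hp0 : (0 : ℝ) ≤ p := Nat.cast_nonneg p
  rw [Sp_zero_eq ht₁ ht₂]
  -- split the summand
  have hsplit : ∀ x X : ZMod p, (if IsUnit x ∧ IsUnit X then
      (ZMod.stdAddChar (ρ * (x - X)) : ℂ) * ((if σ * (1 - t₂ * t₁⁻¹ * x * X⁻¹) = 0 then (p : ℂ) else 0) - 1)
      else 0) =
      (if IsUnit X then (if IsUnit x then (ZMod.stdAddChar (ρ * (x - X)) : ℂ) *
        (if σ * (1 - t₂ * t₁⁻¹ * x * X⁻¹) = 0 then (p : ℂ) else 0) else 0) else 0) -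
      (if IsUnit x ∧ IsUnit X then (ZMod.stdAddChar (ρ * (x - X)) : ℂ) else 0) := by
    intro x X
    by_cases hx : IsUnit x <;> by_cases hX : IsUnit X <;>
      simp only [hx, hX, and_true, and_false, ↓reduceIte] <;> ring
  -- the product structure of the second part
  have hB : ∑ x : ZMod p, ∑ X : ZMod p, (if IsUnit x ∧ IsUnit X then (ZMod.stdAddChar (ρ * (x - X)) : ℂ) else 0) =
      (∑ x : ZMod p, if IsUnit x then (ZMod.stdAddChar (ρ * x) : ℂ) else 0) *
        ∑ X : ZMod p, if IsUnit X then (ZMod.stdAddChar ((-ρ) * X) : ℂ) else 0 := by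
    rw [Finset.sum_mul_sum]
    refine Finset.sum_congr rfl fun x _ => Finset.sum_congr rfl fun X _ => ?_
    by_cases hx : IsUnit x <;> by_cases hX : IsUnit X <;>
      simp only [hx, hX, and_true, and_false, ↓reduceIte, mul_zero, zero_mul]
    rw [← AddChar.map_add_eq_mul]; congr 1; ring
  -- the first double sum: for a unit `X` the `x`-sum is the single term `x₀ = t₁ t₂⁻¹ X`
  have hA : ∀ X : ZMod p, IsUnit X →
      ∑ x : ZMod p, (if IsUnit x then (ZMod.stdAddChar (ρ * (x - X)) : ℂ) *
        (if σ * (1 - t₂ * t₁⁻¹ * x * X⁻¹) = 0 then (p : ℂ) else 0) else 0) =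
      (p : ℂ) * ZMod.stdAddChar ((ρ * (t₁ * t₂⁻¹ - 1)) * X) := by
    intro X hX
    have iX : X * X⁻¹ = 1 := ZMod.mul_inv_of_unit _ hX
    set x₀ : ZMod p := t₁ * t₂⁻¹ * X with hx₀
    have hx₀u : IsUnit x₀ := by
      rw [isUnit_iff_ne_zero_prime] at hX ⊢
      have hti : t₂⁻¹ ≠ 0 := fun h => by rw [h, mul_zero] at i2; exact zero_ne_one i2
      exact mul_ne_zero (mul_ne_zero ht₁ hti) hX
    rw [Finset.sum_eq_single x₀]
    · rw [if_pos hx₀u, if_pos, mul_comm]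
      · congr 2; rw [hx₀]; ring
      · rw [hx₀]
        linear_combination (-(σ * (t₁ * t₁⁻¹) * X * X⁻¹)) * i2 + (-(σ * (X * X⁻¹))) * i1 + (-σ) * iX
    · intro x _ hxne
      by_cases hx : IsUnit x
      · rw [if_pos hx, if_neg, mul_zero]
        intro hc
        apply hxne
        have ix : x * x⁻¹ = 1 := ZMod.mul_inv_of_unit _ hx
        have iσ : σ * σ⁻¹ = 1 := ZMod.mul_inv_of_unit _ ((isUnit_iff_ne_zero_prime σ).mpr hσ)
        rw [hx₀]
        -- `σ (1 − t₂ t₁⁻¹ x X̄) = 0` ⇒ `x = t₁ t₂⁻¹ X`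
        linear_combination (-(t₁ * t₂⁻¹ * X * σ⁻¹)) * hc + (t₁ * t₂⁻¹ * X * (1 - t₂ * t₁⁻¹ * x * X⁻¹)) * iσ +
          (-(x * (t₁ * t₁⁻¹) * (X * X⁻¹))) * i2 + (-(x * (X * X⁻¹))) * i1 + (-x) * iX
      · rw [if_neg hx]
    · intro h; exact absurd (Finset.mem_univ _) h
  simp_rw [hsplit, Finset.sum_sub_distrib]
  rw [hB, sum_isUnit_stdAddChar, sum_isUnit_stdAddChar, if_neg hρ, if_neg (neg_ne_zero.mpr hρ)]
  -- the first double sum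
  have hT1 : ∑ x : ZMod p, ∑ X : ZMod p, (if IsUnit X then (if IsUnit x then (ZMod.stdAddChar (ρ * (x - X)) : ℂ) *
        (if σ * (1 - t₂ * t₁⁻¹ * x * X⁻¹) = 0 then (p : ℂ) else 0) else 0) else 0) =
      (p : ℂ) * ((if ρ * (t₁ * t₂⁻¹ - 1) = 0 then (p : ℂ) else 0) - 1) := by
    rw [Finset.sum_comm, ← sum_isUnit_stdAddChar, Finset.mul_sum]
    refine Finset.sum_congr rfl fun X _ => ?_
    by_cases hX : IsUnit X
    · simp only [if_pos hX]
      rw [hA X hX]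
    · simp only [if_neg hX, Finset.sum_const_zero, mul_zero]
  rw [hT1]
  have hiff : ρ * (t₁ * t₂⁻¹ - 1) = 0 ↔ t₁ - t₂ = 0 := by
    constructor
    · intro h
      rcases mul_eq_zero.mp h with h1 | h1
      · exact absurd h1 hρ
      · linear_combination t₂ * h1 + (-t₁) * i2
    · intro h
      have : t₁ = t₂ := sub_eq_zero.mp h
      rw [this, i2, sub_self, mul_zero]
  refine (norm_sub_le _ _).trans ?_
  rw [norm_mul, Complex.norm_natCast, norm_mul]
  gcongr
  · calc ‖(if ρ * (t₁ * t₂⁻¹ - 1) = 0 then (p : ℂ) else 0) - 1‖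
        = ‖(if t₁ - t₂ = 0 then (p : ℂ) else 0) - 1‖ := by simp only [hiff]
      _ ≤ gp p (t₁ - t₂) := norm_ramanujan_le_gp _
  · have e : ‖(0 : ℂ) - 1‖ = 1 := by simp
    rw [e, mul_one]


/-! #### `k ≢ 0`: the Birch–Bombieri sum -/

/-- **Birch–Bombieri's sum** `S'(α, β) = ∑*_{x,y,X,Y : α x̄ȳ + β X̄Ȳ ≡ 1 (p)} e_p(x + y + X + Y)`.
[cite: HeathBrown1986d3, §3 p.37 (Birch–Bombieri, appendix to [10])] -/
noncomputable def BBsum (p : ℕ) [NeZero p] (α β : ZMod p) : ℂ := by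
  classical
  exact ∑ x : ZMod p, ∑ y : ZMod p, ∑ X : ZMod p, ∑ Y : ZMod p,
    if (IsUnit x ∧ IsUnit y) ∧ (IsUnit X ∧ IsUnit Y) ∧ α * (x⁻¹ * y⁻¹) + β * (X⁻¹ * Y⁻¹) = 1 then
      (ZMod.stdAddChar (x + y + X + Y) : ℂ) else 0

/-- Unfolding `BBsum`. [cite: HeathBrown1986d3, §3 p.37] -/
theorem BBsum_def (α β : ZMod p) : BBsum p α β =
    ∑ x : ZMod p, ∑ y : ZMod p, ∑ X : ZMod p, ∑ Y : ZMod p,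
    if (IsUnit x ∧ IsUnit y) ∧ (IsUnit X ∧ IsUnit Y) ∧ α * (x⁻¹ * y⁻¹) + β * (X⁻¹ * Y⁻¹) = 1 then
      (ZMod.stdAddChar (x + y + X + Y) : ℂ) else 0 := by
  unfold BBsum; congr

set_option maxHeartbeats 1600000 in
/-- **HB's substitution** `x ↦ ρ̄x, y ↦ σ̄y, X ↦ −ρ̄X, Y ↦ −σ̄Y`: for `k, ρ, σ ≢ 0`,
`S'(k, t₁, t₂, ρ, σ) = S'_{BB}(α, β)` with `α = −t₁ρσk̄`, `β = t₂ρσk̄`. [cite: HeathBrown1986d3, §3 p.37] -/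
theorem Sp_eq_BBsum {k ρ σ : ZMod p} (hk : k ≠ 0) (hρ : ρ ≠ 0) (hσ : σ ≠ 0) (t₁ t₂ : ZMod p) :
    Sp p k t₁ t₂ ρ σ = BBsum p (-(t₁ * ρ * σ * k⁻¹)) (t₂ * ρ * σ * k⁻¹) := by
  classical
  have iρ : ρ * ρ⁻¹ = 1 := ZMod.mul_inv_of_unit _ ((isUnit_iff_ne_zero_prime ρ).mpr hρ)
  have iσ : σ * σ⁻¹ = 1 := ZMod.mul_inv_of_unit _ ((isUnit_iff_ne_zero_prime σ).mpr hσ)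
  have ik : k * k⁻¹ = 1 := ZMod.mul_inv_of_unit _ ((isUnit_iff_ne_zero_prime k).mpr hk)
  have hρi : ρ⁻¹ ≠ 0 := fun h => by rw [h, mul_zero] at iρ; exact zero_ne_one iρ
  have hσi : σ⁻¹ ≠ 0 := fun h => by rw [h, mul_zero] at iσ; exact zero_ne_one iσ
  -- unit-ness is preserved by the substitutions
  have hu : ∀ (c : ZMod p), c ≠ 0 → ∀ z : ZMod p, IsUnit (c * z) ↔ IsUnit z := fun c hc z => by
    rw [isUnit_iff_ne_zero_prime, isUnit_iff_ne_zero_prime, mul_ne_zero_iff]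
    exact ⟨fun h => h.2, fun h => ⟨hc, h⟩⟩
  -- inverses of the substituted variables
  have hinv : ∀ (c z : ZMod p), (c * z)⁻¹ = c⁻¹ * z⁻¹ := fun c z => mul_inv c z
  unfold Sp
  rw [BBsum_def]
  rw [← Equiv.sum_comp (Equiv.mulLeft₀ ρ⁻¹ hρi)]
  refine Finset.sum_congr rfl fun x _ => ?_
  rw [← Equiv.sum_comp (Equiv.mulLeft₀ σ⁻¹ hσi)]
  refine Finset.sum_congr rfl fun y _ => ?_
  rw [← Equiv.sum_comp (Equiv.mulLeft₀ (-ρ⁻¹) (neg_ne_zero.mpr hρi))]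
  refine Finset.sum_congr rfl fun X _ => ?_
  rw [← Equiv.sum_comp (Equiv.mulLeft₀ (-σ⁻¹) (neg_ne_zero.mpr hσi))]
  refine Finset.sum_congr rfl fun Y _ => ?_
  simp only [Equiv.mulLeft₀_apply]
  simp only [hu _ hρi, hu _ hσi, hu _ (neg_ne_zero.mpr hρi), hu _ (neg_ne_zero.mpr hσi)]
  by_cases hun : (IsUnit x ∧ IsUnit y) ∧ (IsUnit X ∧ IsUnit Y)
  swap
  · rw [if_neg (fun h => hun ⟨h.1, h.2.1⟩), if_neg (fun h => hun ⟨h.1, h.2.1⟩)]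
  obtain ⟨⟨hx, hy⟩, ⟨hX, hY⟩⟩ := hun
  have hiρ : (ρ⁻¹)⁻¹ = ρ := inv_inv ρ
  have hiσ : (σ⁻¹)⁻¹ = σ := inv_inv σ
  have e1 : (ρ⁻¹ * x)⁻¹ = ρ * x⁻¹ := by rw [hinv, hiρ]
  have e2 : (σ⁻¹ * y)⁻¹ = σ * y⁻¹ := by rw [hinv, hiσ]
  have e3 : (-ρ⁻¹ * X)⁻¹ = -(ρ * X⁻¹) := by rw [hinv, inv_neg, hiρ]; ring
  have e4 : (-σ⁻¹ * Y)⁻¹ = -(σ * Y⁻¹) := by rw [hinv, inv_neg, hiσ]; ring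
  rw [e1, e2, e3, e4]
  have hcond : k + t₁ * (ρ * x⁻¹ * (σ * y⁻¹)) - t₂ * (-(ρ * X⁻¹) * -(σ * Y⁻¹)) = 0 ↔
      -(t₁ * ρ * σ * k⁻¹) * (x⁻¹ * y⁻¹) + t₂ * ρ * σ * k⁻¹ * (X⁻¹ * Y⁻¹) = 1 := by
    constructor
    · intro h
      linear_combination (-k⁻¹) * h + ik
    · intro h
      linear_combination (-k) * h + (-(t₁ * ρ * σ * (x⁻¹ * y⁻¹) - t₂ * ρ * σ * (X⁻¹ * Y⁻¹))) * ik
  have hphase : ρ * (ρ⁻¹ * x) + σ * (σ⁻¹ * y) - ρ * (-ρ⁻¹ * X) - σ * (-σ⁻¹ * Y) = x + y + X + Y := by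
    linear_combination (x + X) * iρ + (y + Y) * iσ
  rw [hphase]
  by_cases hc : k + t₁ * (ρ * x⁻¹ * (σ * y⁻¹)) - t₂ * (-(ρ * X⁻¹) * -(σ * Y⁻¹)) = 0
  · rw [if_pos ⟨⟨hx, hy⟩, ⟨hX, hY⟩, hc⟩, if_pos ⟨⟨hx, hy⟩, ⟨hX, hY⟩, hcond.mp hc⟩]
  · rw [if_neg (fun h => hc h.2.2), if_neg (fun h => hc (hcond.mpr h.2.2))]


/-! #### Lemma 1: assembly -/

/-- `v(x) = 1` if `x ≡ 0 (mod p)`, else `0` (so that `(x, p) = p^{v(x)}`). [folklore] -/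
noncomputable def vz (p : ℕ) (x : ZMod p) : ℕ := by
  classical
  exact if x = 0 then 1 else 0

/-- Unfolding `vz`. [folklore] -/
theorem vz_def (x : ZMod p) : vz p x = if x = 0 then 1 else 0 := by
  unfold vz; congr

omit hp in
/-- `v(x) ≤ 1`. [folklore] -/
theorem vz_le_one (x : ZMod p) : vz p x ≤ 1 := by
  unfold vz; split_ifs <;> omega

/-- `(x, p) = p^{v(x)}`. [folklore] -/
theorem gp_eq_pow (x : ZMod p) : gp p x = (p : ℝ) ^ vz p x := by
  rw [gp_def, vz_def]
  split_ifs <;> simp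

omit hp in
/-- `p^E ≤ p^{5/2} √(p^F)` whenever `2E ≤ 5 + F` (`p ≥ 1`). [folklore] -/
theorem pow_le_rpow_mul_sqrt (hp1 : 1 ≤ p) {E F : ℕ} (h : 2 * E ≤ 5 + F) :
    (p : ℝ) ^ E ≤ (p : ℝ) ^ (5 / 2 : ℝ) * Real.sqrt ((p : ℝ) ^ F) := by
  have hp0 : (0 : ℝ) ≤ p := Nat.cast_nonneg p
  have hp1' : (1 : ℝ) ≤ p := by exact_mod_cast hp1
  have e1 : (p : ℝ) ^ E = Real.sqrt ((p : ℝ) ^ (2 * E)) := by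
    rw [pow_mul', Real.sqrt_sq (by positivity)]
  have e2 : (p : ℝ) ^ (5 / 2 : ℝ) * Real.sqrt ((p : ℝ) ^ F) = Real.sqrt ((p : ℝ) ^ (5 + F)) := by
    rw [pow_add, Real.sqrt_mul (by positivity), Real.sqrt_eq_rpow, Real.sqrt_eq_rpow,
      ← Real.rpow_natCast _ 5, ← Real.rpow_mul hp0]
    norm_num
  rw [e1, e2]
  exact Real.sqrt_le_sqrt (pow_le_pow_right₀ hp1' h)

set_option maxHeartbeats 1600000 in
/-- **Heath-Brown's Lemma 1, modulo the Birch–Bombieri bound** `|S'_{BB}(α, β)| ≤ C p^{3/2}`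
(`p ∤ αβ`): for all `k, t₁, t₂, ρ, σ (mod p)`,
`|S(k, t₁, t₂, ρ, σ; p)| ≤ (C + 3) p^{5/2} {(k, t₁ − t₂, p)(t₁, p)(t₂, p)(ρ, p)(σ, p)}^{1/2}`,
written with `(x, p) = p^{v(x)}` and `(k, t₁ − t₂, p) = p^{[k ≡ 0 ∧ t₁ ≡ t₂]}`.
[cite: HeathBrown1986d3, Lemma 1] -/
theorem norm_SS_prime_le_of_BB {C : ℝ} (hC : 0 ≤ C)
    (hBB : ∀ α β : ZMod p, α ≠ 0 → β ≠ 0 → ‖BBsum p α β‖ ≤ C * (p : ℝ) ^ (3 / 2 : ℝ))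
    (k t₁ t₂ ρ σ : ZMod p) :
    ‖SS p k t₁ t₂ ρ σ‖ ≤ (C + 3) * ((p : ℝ) ^ (5 / 2 : ℝ) *
      Real.sqrt ((p : ℝ) ^ ((if k = 0 ∧ t₁ = t₂ then 1 else 0) + vz p t₁ + vz p t₂ + vz p ρ + vz p σ))) := by
  classical
  have hP : p.Prime := hp.out
  have hp1 : 1 ≤ p := hP.one_lt.le
  have hp2 : (2 : ℝ) ≤ p := by exact_mod_cast hP.two_le
  have hp0 : (0 : ℝ) < p := by linarith
  have hC3 : (1 : ℝ) ≤ C + 3 := by linarith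
  have vk1 := vz_le_one t₁; have vk2 := vz_le_one t₂; have vρ1 := vz_le_one ρ; have vσ1 := vz_le_one σ
  set vKD : ℕ := if k = 0 ∧ t₁ = t₂ then 1 else 0 with hvKD
  have vKD1 : vKD ≤ 1 := by rw [hvKD]; split_ifs <;> omega
  set F : ℕ := vKD + vz p t₁ + vz p t₂ + vz p ρ + vz p σ with hF
  -- a convenient packaging of the target
  have main3 : ∀ E : ℕ, 2 * E ≤ 5 + F → ∀ B : ℝ, B ≤ 3 * (p : ℝ) ^ E →
      B ≤ (C + 3) * ((p : ℝ) ^ (5 / 2 : ℝ) * Real.sqrt ((p : ℝ) ^ F)) := fun E hE B hB =>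
    hB.trans (mul_le_mul (by linarith) (pow_le_rpow_mul_sqrt hp1 hE) (by positivity) (by linarith))
  have main : ∀ E : ℕ, 2 * E ≤ 5 + F → ∀ B : ℝ, B ≤ (p : ℝ) ^ E →
      B ≤ (C + 3) * ((p : ℝ) ^ (5 / 2 : ℝ) * Real.sqrt ((p : ℝ) ^ F)) := fun E hE B hB =>
    main3 E hE B (hB.trans (le_mul_of_one_le_left (by positivity) (by norm_num)))
  by_cases hρ : ρ = 0
  · subst hρ
    refine main (vz p k + vz p t₁ + vz p t₂ + 2 * vz p σ) ?_ _ ?_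
    · have hvρ : vz p (0 : ZMod p) = 1 := by rw [vz_def, if_pos rfl]
      have hk1 := vz_le_one k
      have himp : vz p k = 1 → vz p t₁ = 1 → vz p t₂ = 1 → vKD = 1 := by
        intro h1 h2 h3
        rw [vz_def] at h1 h2 h3
        split_ifs at h1 h2 h3 with hk0 ht10 ht20
        rw [hvKD, if_pos ⟨hk0, by rw [ht10, ht20]⟩]
      rw [hF, hvρ]; omega
    · refine (norm_SS_prime_first_zero_le k t₁ t₂ σ).trans (le_of_eq ?_)
      rw [gp_eq_pow, gp_eq_pow, gp_eq_pow, gp_eq_pow]; ring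
  by_cases hσ : σ = 0
  · subst hσ
    refine main (vz p k + vz p t₁ + vz p t₂ + 2 * vz p ρ) ?_ _ ?_
    · have hvσ : vz p (0 : ZMod p) = 1 := by rw [vz_def, if_pos rfl]
      have hk1 := vz_le_one k
      have himp : vz p k = 1 → vz p t₁ = 1 → vz p t₂ = 1 → vKD = 1 := by
        intro h1 h2 h3
        rw [vz_def] at h1 h2 h3
        split_ifs at h1 h2 h3 with hk0 ht10 ht20
        rw [hvKD, if_pos ⟨hk0, by rw [ht10, ht20]⟩]
      rw [hF, hvσ]; omega
    · refine (norm_SS_prime_second_zero_le k t₁ t₂ ρ).trans (le_of_eq ?_)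
      rw [gp_eq_pow, gp_eq_pow, gp_eq_pow, gp_eq_pow]; ring
  by_cases ht : t₁ = 0 ∨ t₂ = 0
  · refine main 3 ?_ _ (norm_SS_prime_le_cube k t₁ t₂ ρ σ ht hρ hσ)
    have : 1 ≤ vz p t₁ + vz p t₂ := by
      rcases ht with h | h
      · rw [vz_def t₁, if_pos h]; omega
      · rw [vz_def t₂, if_pos h]; omega
    rw [hF]; omega
  rw [not_or] at ht
  obtain ⟨ht₁, ht₂⟩ := ht
  have h00 : K2 p ρ σ 0 * starRingEnd ℂ (K2 p ρ σ 0) = 1 := by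
    have : K2 p ρ σ 0 = 1 := by rw [K2_third_zero, if_neg hρ, if_neg hσ]; ring
    rw [this, map_one, mul_one]
  rw [SS_prime_eq, h00]
  by_cases hk : k = 0
  · subst hk
    have hSp := norm_Sp_zero_le ht₁ ht₂ hρ hσ
    refine main3 (2 + vKD) (by rw [hF]; omega) _ ?_
    have hgp : gp p (t₁ - t₂) = (p : ℝ) ^ vKD := by
      rw [gp_def, hvKD]
      by_cases h12 : t₁ = t₂
      · rw [if_pos (sub_eq_zero.mpr h12), if_pos ⟨rfl, h12⟩, pow_one]
      · rw [if_neg (fun h => h12 (sub_eq_zero.mp h)), if_neg (fun h => h12 h.2), pow_zero]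
    rw [hgp] at hSp
    have h1 : (1 : ℝ) ≤ (p : ℝ) ^ vKD := one_le_pow₀ (by linarith)
    calc ‖(p : ℂ) * Sp p 0 t₁ t₂ ρ σ - 1‖ ≤ ‖(p : ℂ) * Sp p 0 t₁ t₂ ρ σ‖ + ‖(1 : ℂ)‖ := norm_sub_le _ _
      _ ≤ p * (p * (p : ℝ) ^ vKD + 1) + 1 := by
          rw [norm_mul, Complex.norm_natCast, norm_one]
          gcongr
      _ ≤ 3 * (p : ℝ) ^ (2 + vKD) := by
          rw [pow_add]
          nlinarith
  · have hSp : ‖Sp p k t₁ t₂ ρ σ‖ ≤ C * (p : ℝ) ^ (3 / 2 : ℝ) := by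
      rw [Sp_eq_BBsum hk hρ hσ]
      refine hBB _ _ ?_ ?_
      · have ik : k * k⁻¹ = 1 := ZMod.mul_inv_of_unit _ ((isUnit_iff_ne_zero_prime k).mpr hk)
        have hki : k⁻¹ ≠ 0 := fun h => by rw [h, mul_zero] at ik; exact zero_ne_one ik
        exact neg_ne_zero.mpr (mul_ne_zero (mul_ne_zero (mul_ne_zero ht₁ hρ) hσ) hki)
      · have ik : k * k⁻¹ = 1 := ZMod.mul_inv_of_unit _ ((isUnit_iff_ne_zero_prime k).mpr hk)
        have hki : k⁻¹ ≠ 0 := fun h => by rw [h, mul_zero] at ik; exact zero_ne_one ik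
        exact mul_ne_zero (mul_ne_zero (mul_ne_zero ht₂ hρ) hσ) hki
    have h1F : (1 : ℝ) ≤ Real.sqrt ((p : ℝ) ^ F) := by
      rw [← Real.sqrt_one]; exact Real.sqrt_le_sqrt (one_le_pow₀ (by linarith))
    have h52 : (p : ℝ) * (p : ℝ) ^ (3 / 2 : ℝ) = (p : ℝ) ^ (5 / 2 : ℝ) := by
      rw [show (5 / 2 : ℝ) = 1 + 3 / 2 by norm_num, Real.rpow_add hp0, Real.rpow_one]
    have h1le : (1 : ℝ) ≤ (p : ℝ) ^ (5 / 2 : ℝ) := Real.one_le_rpow (by linarith) (by norm_num)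
    calc ‖(p : ℂ) * Sp p k t₁ t₂ ρ σ - 1‖ ≤ ‖(p : ℂ) * Sp p k t₁ t₂ ρ σ‖ + ‖(1 : ℂ)‖ := norm_sub_le _ _
      _ ≤ p * (C * (p : ℝ) ^ (3 / 2 : ℝ)) + 1 := by
          rw [norm_mul, Complex.norm_natCast, norm_one]
          gcongr
      _ = C * (p : ℝ) ^ (5 / 2 : ℝ) + 1 := by rw [← h52]; ring
      _ ≤ (C + 3) * ((p : ℝ) ^ (5 / 2 : ℝ) * 1) := by nlinarith
      _ ≤ (C + 3) * ((p : ℝ) ^ (5 / 2 : ℝ) * Real.sqrt ((p : ℝ) ^ F)) := by gcongr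


/-! #### Lemma 1 in the `L4B` form, and Lemma 4 modulo Birch–Bombieri -/

/-- `p^{v(x mod p)} = (x, p)` for an integer `x`. [folklore] -/
theorem pow_vz_intCast (x : ℤ) : (p : ℝ) ^ vz p (x : ZMod p) = (Nat.gcd x.natAbs p : ℝ) := by
  rw [vz_def]
  by_cases hx : ((x : ℤ) : ZMod p) = 0
  · rw [if_pos hx, pow_one]
    rw [ZMod.intCast_zmod_eq_zero_iff_dvd] at hx
    rw [Nat.gcd_eq_right (Int.natCast_dvd.mp hx)]
  · rw [if_neg hx, pow_zero]
    have hx' : ¬ ((p : ℤ) ∣ x) := fun h => hx ((ZMod.intCast_zmod_eq_zero_iff_dvd x p).mpr h)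
    have : Nat.Coprime x.natAbs p :=
      Nat.coprime_comm.mp ((Nat.Prime.coprime_iff_not_dvd hp.out).mpr (fun h => hx' (Int.natCast_dvd.mpr h)))
    rw [Nat.Coprime.gcd_eq_one this, Nat.cast_one]

/-- `p^{[k ≡ 0 ∧ t₁ ≡ t₂]} ≤ (k², (t₁ − t₂)², p)`. [folklore] -/
theorem pow_vKD_le (k t₁ t₂ : ℤ) :
    (p : ℝ) ^ (if ((k : ℤ) : ZMod p) = 0 ∧ ((t₁ : ℤ) : ZMod p) = ((t₂ : ℤ) : ZMod p) then 1 else 0) ≤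
      (Nat.gcd (Nat.gcd (k ^ 2).natAbs ((t₁ - t₂) ^ 2).natAbs) p : ℝ) := by
  have hG : Nat.gcd (Nat.gcd (k ^ 2).natAbs ((t₁ - t₂) ^ 2).natAbs) p ≠ 0 := Nat.gcd_ne_zero_right hp.out.ne_zero
  split_ifs with h
  · obtain ⟨hk, ht⟩ := h
    rw [ZMod.intCast_zmod_eq_zero_iff_dvd] at hk
    rw [← sub_eq_zero, ← Int.cast_sub, ZMod.intCast_zmod_eq_zero_iff_dvd] at ht
    rw [pow_one]
    exact_mod_cast Nat.le_of_dvd (Nat.pos_of_ne_zero hG) (Nat.dvd_gcd (Nat.dvd_gcd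
      (by rw [Int.natAbs_pow]; exact dvd_pow (Int.natCast_dvd.mp hk) two_ne_zero)
      (by rw [Int.natAbs_pow]; exact dvd_pow (Int.natCast_dvd.mp ht) two_ne_zero)) dvd_rfl)
  · rw [pow_zero]
    exact_mod_cast Nat.pos_of_ne_zero hG

/-- **Lemma 1 in the form needed by Lemma 4**: `|S(·; p)| ≤ (C + 3) · L4B(p; ·)` for integer
parameters, modulo the Birch–Bombieri bound at `p`. [cite: HeathBrown1986d3, Lemma 1] -/
theorem norm_SS_prime_le_L4B_of_BB {C : ℝ} (hC : 0 ≤ C)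
    (hBB : ∀ α β : ZMod p, α ≠ 0 → β ≠ 0 → ‖BBsum p α β‖ ≤ C * (p : ℝ) ^ (3 / 2 : ℝ))
    (k t₁ t₂ ρ σ : ℤ) :
    ‖SS p k t₁ t₂ ρ σ‖ ≤ (C + 3) * L4B p k t₁ t₂ ρ σ := by
  have h0 := norm_SS_prime_le_of_BB hC hBB (k : ZMod p) (t₁ : ZMod p) (t₂ : ZMod p) (ρ : ZMod p) (σ : ZMod p)
  refine h0.trans ?_
  rw [L4B_def]
  have h1 := one_le_G2_rpow hp.out.ne_zero t₁ t₂
  have hC3 : (0 : ℝ) ≤ C + 3 := by linarith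
  refine mul_le_mul_of_nonneg_left ?_ hC3
  rw [mul_assoc]
  refine mul_le_mul_of_nonneg_left ?_ (by positivity)
  refine le_trans (Real.sqrt_le_sqrt ?_) (le_mul_of_one_le_right (Real.sqrt_nonneg _) h1)
  have hKD := pow_vKD_le (p := p) k t₁ t₂
  rw [pow_add, pow_add, pow_add, pow_add, pow_vz_intCast, pow_vz_intCast, pow_vz_intCast, pow_vz_intCast]
  simp only [mul_assoc]
  exact mul_le_mul_of_nonneg_right hKD (by positivity)

end Lemma1

/-- **Heath-Brown's Lemma 4, modulo the Birch–Bombieri bound**: if `|S'_{BB}(α, β; p)| ≤ C p^{3/2}`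
for all primes `p` and `p ∤ αβ` (Birch–Bombieri, appendix to [10] — a consequence of Deligne's
theorem), then for every `q ≥ 1` and all integers `k, t₁, t₂, ρ, σ`,
`|S(k, t₁, t₂, ρ, σ; q)| ≤ max(C + 3, 96)^{ω(q)} · L4B(q; k, t₁, t₂, ρ, σ)`
(and `max(C+3, 96)^{ω(q)} ≤ d(q)^{log₂ max(C+3,96)} = d_A(q)`). [cite: HeathBrown1986d3, Lemma 4] -/
theorem norm_SS_le_L4B_of_BB {C : ℝ} (hC : 0 ≤ C)
    (hBB : ∀ (p : ℕ) [Fact p.Prime] (α β : ZMod p), α ≠ 0 → β ≠ 0 →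
      ‖BBsum p α β‖ ≤ C * (p : ℝ) ^ (3 / 2 : ℝ))
    (q : ℕ) [NeZero q] (k t₁ t₂ ρ σ : ℤ) :
    ‖SS q k t₁ t₂ ρ σ‖ ≤ max (C + 3) 96 ^ q.primeFactors.card * L4B q k t₁ t₂ ρ σ :=
  norm_SS_le_L4B (fun p _ k t₁ t₂ ρ σ => norm_SS_prime_le_L4B_of_BB hC (hBB p) k t₁ t₂ ρ σ) q k t₁ t₂ ρ σ

/-- The same in the printed `d_A(q)` form. [cite: HeathBrown1986d3, Lemma 4] -/
theorem norm_SS_le_dA_L4B_of_BB {C : ℝ} (hC : 0 ≤ C)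
    (hBB : ∀ (p : ℕ) [Fact p.Prime] (α β : ZMod p), α ≠ 0 → β ≠ 0 →
      ‖BBsum p α β‖ ≤ C * (p : ℝ) ^ (3 / 2 : ℝ))
    (q : ℕ) [NeZero q] (k t₁ t₂ ρ σ : ℤ) :
    ‖SS q k t₁ t₂ ρ σ‖ ≤ ((Nat.divisors q).card : ℝ) ^ (Real.logb 2 (max (C + 3) 96)) * L4B q k t₁ t₂ ρ σ :=
  norm_SS_le_dA_L4B (fun p _ k t₁ t₂ ρ σ => norm_SS_prime_le_L4B_of_BB hC (hBB p) k t₁ t₂ ρ σ) q k t₁ t₂ ρ σ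

end Literature.NumberTheory.Sieve.HeathBrown1986
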